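import Literature.MathematicalPhysics.QuantumFieldTheory.BalabanImbrieJaffe1984to88.BIJ88Sect2SigmaAllTori
import Literature.MathematicalPhysics.QuantumFieldTheory.BalabanImbrieJaffe1984to88.BIJ85Prop12AllTori

/-!
# `BalabanImbrieJaffe1984to88.BIJ85Sect72AllToriHolds` — [BalabanImbrieJaffe1985] Sect. 7.2 and [BalabanImbrieJaffe1988] Sect. 2's `σ_k`
paragraph OVER ALL TORI, HYPOTHESIS-FREE: the all-tori theorems of `BIJ85Sect72AllTori` and `BIJ88Sect2SigmaAllTori` (seat p16 gen 7)
with their only hypothesis — [6I] = [Balaban1984PropagatorsI] Proposition 1.2 over the all-tori index — DISCHARGED by seat p19 gen 6's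
`BIJ85Prop12AllTori.prop12Printed_allTori` (the Prop. 1.2 family bridge ← `B5Prop12GHolds.prop12_famG_printed`, p37 g7).  (The `C_k`
paragraph (2.23)/(2.25)/(2.26) and the (2.13) decay over all tori — `BIJ88Sect2CkAllTori` and its twins `BIJ88Decay223CkAllTori` /
`BIJ88Decay213DkLocAllTori` of seat p08 gen 9 — are instantiated by seat p08, not here.)

statement-level skeleton of published theorems with citation tags; proofs where landed; nothing here is a claim about the Yang–Mills mass gap

CITATION HEADER (lean-in-tree rule).  Part of the lit-balaban TYPED SKELETON (HOME `run/shared/lean/pub/lit-balaban/`), Phase-2 proof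
seat p16 gen 7 (sixth file); rows **C1.Eq7.2.1-7.2.2, C1.Eq7.2.4** (owner r15) and **C2.Eq2.16, 2.17, 2.18, 2.19** (fold owner r18);
referee ref-5.  Every theorem below is a one-line instantiation `…_of_prop12Printed … (prop12Printed_allTori d L ha)`;
the mathematics is in the cited files (p09 g4–g6, p08 g7–g8, p33 g7, p37 g7/p38 g6 (Prop. 1.2 for G), p19 g6, p16 g7).

WHAT IS PROVED (theorems only, NO hypothesis beyond `d ≥ 1` resp. `d ≥ 2`, `L` odd `> 1`, `a > 0`): for EVERY torus `T_η` of the series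
with `P.d = d`, `P.L = L` (every volume `L^m`, every `ε = L^{−K}`) and every scale in the stated range, with ONE constant set:
(7.2.2) `ineq722_allTori` (r15's `KernelData.Ineq722` along a surjective enumeration of all tori and scales `1 ≤ k ≤ m + K`) and
`exists_absH_le_allTori`; (7.2.4) `exists_ineq724_allTori`; the `𝒟_k` sentence `decayDk_allTori`; [BIJ88] (2.16) `decay216_allTori`,
(2.17) `ineq217_allTori`, (2.18) `close218_allTori`, (2.19) `ineq219_allTori`, bundle `sect2_sigma_allTori`; and the uniform gradient
input `exists_gradB_allTori` (|∇H_j| at every scale `0 ≤ j ≤ m + K` of every torus, ONE `(δ, M)`).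
-/

namespace Literature.MathematicalPhysics.QuantumFieldTheory.BalabanImbrieJaffe1984to88.BIJ85Sect72AllToriHolds

open Literature.MathematicalPhysics.QuantumFieldTheory.Balaban1983to89 hiding Site Plaq
open scoped BigOperators RealInnerProductSpace
open Balaban1983to89.LatticeFieldCalculus
open Balaban1983to89.T4AxialGaugeSmallField (castSite boxPlaqs)
open BIJ88SigmaKernelDkTorus BIJ88Ineq217Ineq722Torus BIJ88Ineq217NearPart BIJ88Decay216Torus
open BIJ88Sect2Statements (supNorm Ineq219 Close trunc)
open BIJ85AxialPropagator411 BIJ85Prop521Torus BIJ85Sigma421Torus BIJ85Prop522Torus BIJ85Sigma422Eta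
open BIJ85Sect7Statements BIJ85Ineq722Torus BIJ85Eq721MinimizerKernel
open BIJ85Ineq722Proof BIJ85Ineq722Proof.Rep103 BIJ85Ineq722ProofPart2
open BIJ85Ineq722DeltaA (deltaAData)
open BIJ85Sect72AllTori BIJ88Sect2SigmaAllTori
open BIJ85Prop12AllTori (prop12Printed_allTori)
open BIJ85Ineq724Proof (Dk)
open BIJ88Ineq219SigmaTorus (pdist_comm)
open BIJ85SigmaClosedCube (c711)

open Balaban1983to89 renaming Site → TSite, Plaq → TPlaq

noncomputable section

/-! ## [BIJ85] Sect. 7.2 over all tori, hypothesis-free -/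

/-- **(7.2.2) OVER ALL TORI, HYPOTHESIS-FREE**: r15's `KernelData.Ineq722` — ONE `δ > 0`, ONE `M(α)` — along a surjective enumeration of ALL
tori `T_η` of dimension `d`, block size `L` and ALL scales `1 ≤ k ≤ m + K`, for the printed `H_k = G_kQ_k^*(Q_kG_kQ_k^*)⁻¹`, `G_k = Δ_a⁻¹`.
[cite: BalabanImbrieJaffe1985, (7.2.2) p.325] -/
theorem ineq722_allTori {d L : ℕ} (hd : 1 ≤ d) (hL : Odd L ∧ 1 < L) {a : ℝ} (ha : 0 < a)
    (BondU : {x : Params × ℕ // x.1.d = d ∧ x.1.L = L ∧ 1 ≤ x.2 ∧ x.2 ≤ x.1.m + x.1.K} → Type)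
    (distEB : (i : {x : Params × ℕ // x.1.d = d ∧ x.1.L = L ∧ 1 ≤ x.2 ∧ x.2 ≤ x.1.m + x.1.K}) → TSite i.1.1 0 → BondU i → ℝ)
    (Cker : (i : {x : Params × ℕ // x.1.d = d ∧ x.1.L = L ∧ 1 ≤ x.2 ∧ x.2 ≤ x.1.m + x.1.K}) →
      Fin i.1.1.d → Fin i.1.1.d → TSite i.1.1 i.1.2 → TSite i.1.1 i.1.2 → ℝ)
    (Dker : (i : {x : Params × ℕ // x.1.d = d ∧ x.1.L = L ∧ 1 ≤ x.2 ∧ x.2 ≤ x.1.m + x.1.K}) → TSite i.1.1 0 → BondU i → ℝ) :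
    ∃ e : ℕ → {x : Params × ℕ // x.1.d = d ∧ x.1.L = L ∧ 1 ≤ x.2 ∧ x.2 ≤ x.1.m + x.1.K}, Function.Surjective e ∧
      KernelData.Ineq722 (fun n => torusKernelData (e n).1.1 (e n).1.2 (deltaAData (e n).2.2.2.2 a) (BondU (e n)) (distEB (e n))
        (Cker (e n)) (Dker (e n))) :=
  ineq722_allTori_of_prop12Printed hd hL ha (prop12Printed_allTori d L ha) BondU distEB Cker Dker

/-- **The `|H|` member of (7.2.2) over all tori, hypothesis-free**: `∃ δ > 0, M ≥ 1`, `|H_{k,μν}(x, y)| ≤ Me^{−δ|x − y|}` for every torus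
(`P.d = d`, `P.L = L`) and every `1 ≤ k ≤ m + K`. [cite: BalabanImbrieJaffe1985, (7.2.2) p.325] -/
theorem exists_absH_le_allTori {d L : ℕ} (hd : 1 ≤ d) (hL : Odd L ∧ 1 < L) {a : ℝ} (ha : 0 < a) :
    ∃ δ M : ℝ, 0 < δ ∧ 1 ≤ M ∧ ∀ (P : Params) (hPd : P.d = d) (hPL : P.L = L) (k : ℕ) (hk1 : 1 ≤ k) (hk : k ≤ P.m + P.K)
      (μ ν : Fin P.d) (x : TSite P 0) (y : TSite P k),
      |(torusRep P k (deltaAData hk a)).H (x, μ) (y, ν)| ≤ M * Real.exp (-(δ * distEU P k x y)) :=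
  exists_absH_le_allTori_of_prop12Printed hd hL ha (prop12Printed_allTori d L ha)

/-- **`|∇H_j|` at every scale `0 ≤ j ≤ m + K` of every torus with ONE `(δ, M)`, hypothesis-free** (the `hB` input of p08's explicit
lemmas). [cite: BalabanImbrieJaffe1985, (7.2.2) p.325] -/
theorem exists_gradB_allTori {d L : ℕ} (hd : 1 ≤ d) (hL : Odd L ∧ 1 < L) {a : ℝ} (ha : 0 < a) :
    ∃ δ M : ℝ, 0 < δ ∧ 0 ≤ M ∧ ∀ (P : Params) (hPd : P.d = d) (hPL : P.L = L) (j : ℕ) (hj : j ≤ P.m + P.K)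
      (μ ν : Fin P.d) (x : TSite P 0) (y : TSite P j),
      ‖fun lam : Fin P.d => (P.L : ℝ) ^ j *
          ((torusRep P j (deltaAData hj a)).H (x.shift lam, μ) (y, ν) - (torusRep P j (deltaAData hj a)).H (x, μ) (y, ν))‖ ≤
        M * Real.exp (-(δ * distEU P j x y)) :=
  exists_gradB_allTori_of_prop12Printed hd hL ha (prop12Printed_allTori d L ha)

/-- **(7.2.4) OVER ALL TORI, HYPOTHESIS-FREE**: ONE `(M, δ)`, `δ > 0`, with r15's `KernelData.Ineq724 M δ` for p09's carrier with
`D_k = Dk (L^k) k H_k` on every torus (`P.d = d`, `P.L = L`) and every `1 ≤ k ≤ m + K`. [cite: BalabanImbrieJaffe1985, (7.2.4) p.326] -/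
theorem exists_ineq724_allTori {d L : ℕ} (hd : 1 ≤ d) (hL : Odd L ∧ 1 < L) {a : ℝ} (ha : 0 < a) :
    ∃ M δ : ℝ, 0 < δ ∧ ∀ (P : Params) (hPd : P.d = d) (hPL : P.L = L) (k : ℕ) (hk1 : 1 ≤ k) (hk : k ≤ P.m + P.K)
      (Ck : Fin P.d → Fin P.d → TSite P k → TSite P k → ℝ),
      (torusKernelData P k (deltaAData hk a) (PBond P k) (fun x b => distEU P k x b.src) Ck
        (Dk ((P.L : ℝ) ^ k) k (fun μ ν x y => (torusRep P k (deltaAData hk a)).H (x, μ) (y, ν)))).Ineq724 M δ :=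
  exists_ineq724_allTori_of_prop12Printed hd hL ha (prop12Printed_allTori d L ha)

/-- **p. 326 «the operators 𝒟_k … exponential decay» OVER ALL TORI, HYPOTHESIS-FREE** (`2 ≤ d`): ONE `(R₀, c₀, δ′)` for p11's
`𝒟_k = DkE P η_k^d L^k k` on every torus and every `k ≤ m + K`. [cite: BalabanImbrieJaffe1985, (4.4.4) p.312] -/
theorem decayDk_allTori {d L : ℕ} (hd : 2 ≤ d) (hL : Odd L ∧ 1 < L) {a : ℝ} (ha : 0 < a) :
    ∃ R₀ c₀ δ' : ℝ, 0 < δ' ∧ 0 ≤ c₀ ∧ ∀ (P : Params) (hPd : P.d = d) (hPL : P.L = L) (k : ℕ) (hk : k ≤ P.m + P.K)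
      (b b'' : PBond P 0), R₀ ≤ (supDist b.src b''.src : ℝ) / (P.L : ℝ) ^ k →
        |DkE P ((P.eta k) ^ P.d) ((P.L : ℝ) ^ k) k (toE P (Pi.single b'' 1)) b| ≤
          c₀ * Real.exp (-δ' * ((supDist b.src b''.src : ℝ) / (P.L : ℝ) ^ k)) :=
  decayDk_allTori_of_prop12Printed hd hL ha (prop12Printed_allTori d L ha)

/-! ## [BIJ88] Sect. 2's `σ_k` paragraph over all tori, hypothesis-free -/

/-- **(2.16) OVER ALL TORI, HYPOTHESIS-FREE** (`2 ≤ d`). [cite: BalabanImbrieJaffe1988, (2.16) p.262] -/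
theorem decay216_allTori {d L : ℕ} (hd : 2 ≤ d) (hL : Odd L ∧ 1 < L) {a : ℝ} (ha : 0 < a) :
    ∃ R₀ c₀ δ' : ℝ, 0 < δ' ∧ 0 ≤ c₀ ∧ ∀ (P : Params) (hPd : P.d = d) (hPL : P.L = L) (hdP : 2 ≤ P.d) (k : ℕ) (hk : k ≤ P.m + P.K)
      (p₁ p₂ : TPlaq P k), R₀ ≤ pdist p₁ p₂ →
        |sigmaTorus (P := P) hdP ((P.eta k) ^ P.d) ((P.L : ℝ) ^ k) k (toU P k (Pi.single p₂ 1)) p₁| ≤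
          c₀ * Real.exp (-δ' * pdist p₁ p₂) :=
  decay216_allTori_of_prop12Printed hd hL ha (prop12Printed_allTori d L ha)

/-- **(2.17) OVER ALL TORI, HYPOTHESIS-FREE** (`2 ≤ d`). [cite: BalabanImbrieJaffe1988, (2.17) p.262] -/
theorem ineq217_allTori {d L : ℕ} (hd : 2 ≤ d) (hL : Odd L ∧ 1 < L) {a : ℝ} (ha : 0 < a) :
    ∃ R₀ C : ℝ, 0 ≤ C ∧ ∀ (P : Params) (hPd : P.d = d) (hPL : P.L = L) (hdP : 2 ≤ P.d) (k : ℕ) (hk : k ≤ P.m + P.K) (R : ℕ),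
      R₀ ≤ R → 2 * R < P.sitesPerDir k →
      ∀ (p₁ : TPlaq P k) (z₁ : Fin P.d → ℤ), p₁.src = castSite z₁ →
      ∀ (f : TPlaq P k → ℝ) (A : VecField P k ℝ), (∀ p ∈ boxPlaqs (loOf z₁ R) (hiOf z₁ R), f p = curl 1 A p) →
        |sigmaTorus (P := P) hdP ((P.eta k) ^ P.d) ((P.L : ℝ) ^ k) k (toU P k f) p₁| ≤ C * (1 + R) * supNorm f :=
  ineq217_allTori_of_prop12Printed hd hL ha (prop12Printed_allTori d L ha)

/-- **(2.18) OVER ALL TORI, HYPOTHESIS-FREE** (`2 ≤ d`). [cite: BalabanImbrieJaffe1988, (2.18) p.262] -/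
theorem close218_allTori {d L : ℕ} (hd : 2 ≤ d) (hL : Odd L ∧ 1 < L) {a : ℝ} (ha : 0 < a) :
    ∃ R₀ c₀ δ' : ℝ, 0 < δ' ∧ 0 ≤ c₀ ∧ ∀ (P : Params) (hPd : P.d = d) (hPL : P.L = L) (hdP : 2 ≤ P.d) (k : ℕ) (hk : k ≤ P.m + P.K)
      (R : ℝ), R₀ ≤ R →
        Close pdist (trunc pdist R fun p q => sigmaTorus (P := P) hdP ((P.eta k) ^ P.d) ((P.L : ℝ) ^ k) k (toU P k (Pi.single q 1)) p)
          (fun p q => sigmaTorus (P := P) hdP ((P.eta k) ^ P.d) ((P.L : ℝ) ^ k) k (toU P k (Pi.single q 1)) p)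
          (c₀ * Real.exp (-(δ' / 2) * R)) (δ' / 2) :=
  close218_allTori_of_prop12Printed hd hL ha (prop12Printed_allTori d L ha)

/-- **(2.19) OVER ALL TORI, HYPOTHESIS-FREE — ONE truncation radius for every torus and scale** (`2 ≤ d`). [cite: BalabanImbrieJaffe1988, (2.19) p.262] -/
theorem ineq219_allTori {d L : ℕ} (hd : 2 ≤ d) (hL : Odd L ∧ 1 < L) {a : ℝ} (ha : 0 < a) :
    ∃ R₁ : ℝ, ∀ (P : Params) (hPd : P.d = d) (hPL : P.L = L) (hdP : 2 ≤ P.d) (k : ℕ) (hk : k ≤ P.m + P.K) (R : ℝ), R₁ ≤ R →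
        Ineq219 (trunc pdist R fun p q => sigmaTorus (P := P) hdP ((P.eta k) ^ P.d) ((P.L : ℝ) ^ k) k (toU P k (Pi.single q 1)) p)
          (c711 d) :=
  ineq219_allTori_of_prop12Printed hd hL ha (prop12Printed_allTori d L ha)

/-- **(2.16)–(2.19) OVER ALL TORI, HYPOTHESIS-FREE, bundled** (`2 ≤ d`). [cite: BalabanImbrieJaffe1988, (2.16)–(2.19) pp.261–262] -/
theorem sect2_sigma_allTori {d L : ℕ} (hd : 2 ≤ d) (hL : Odd L ∧ 1 < L) {a : ℝ} (ha : 0 < a) :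
    ∃ R₀ c₀ δ' C R₁ : ℝ, 0 < δ' ∧ 0 ≤ c₀ ∧ 0 ≤ C ∧ 0 < c711 d ∧
      (∀ (P : Params) (hPd : P.d = d) (hPL : P.L = L) (hdP : 2 ≤ P.d) (k : ℕ) (hk : k ≤ P.m + P.K) (p₁ p₂ : TPlaq P k),
        R₀ ≤ pdist p₁ p₂ →
        |sigmaTorus (P := P) hdP ((P.eta k) ^ P.d) ((P.L : ℝ) ^ k) k (toU P k (Pi.single p₂ 1)) p₁| ≤
          c₀ * Real.exp (-δ' * pdist p₁ p₂)) ∧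
      (∀ (P : Params) (hPd : P.d = d) (hPL : P.L = L) (hdP : 2 ≤ P.d) (k : ℕ) (hk : k ≤ P.m + P.K) (R : ℕ),
        R₀ ≤ R → 2 * R < P.sitesPerDir k →
        ∀ (p₁ : TPlaq P k) (z₁ : Fin P.d → ℤ), p₁.src = castSite z₁ →
        ∀ (f : TPlaq P k → ℝ) (A : VecField P k ℝ), (∀ p ∈ boxPlaqs (loOf z₁ R) (hiOf z₁ R), f p = curl 1 A p) →
          |sigmaTorus (P := P) hdP ((P.eta k) ^ P.d) ((P.L : ℝ) ^ k) k (toU P k f) p₁| ≤ C * (1 + R) * supNorm f) ∧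
      (∀ (P : Params) (hPd : P.d = d) (hPL : P.L = L) (hdP : 2 ≤ P.d) (k : ℕ) (hk : k ≤ P.m + P.K) (R : ℝ), R₀ ≤ R →
        Close pdist (trunc pdist R fun p q => sigmaTorus (P := P) hdP ((P.eta k) ^ P.d) ((P.L : ℝ) ^ k) k (toU P k (Pi.single q 1)) p)
          (fun p q => sigmaTorus (P := P) hdP ((P.eta k) ^ P.d) ((P.L : ℝ) ^ k) k (toU P k (Pi.single q 1)) p)
          (c₀ * Real.exp (-(δ' / 2) * R)) (δ' / 2)) ∧
      (∀ (P : Params) (hPd : P.d = d) (hPL : P.L = L) (hdP : 2 ≤ P.d) (k : ℕ) (hk : k ≤ P.m + P.K) (R : ℝ), R₁ ≤ R →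
        Ineq219 (trunc pdist R fun p q => sigmaTorus (P := P) hdP ((P.eta k) ^ P.d) ((P.L : ℝ) ^ k) k (toU P k (Pi.single q 1)) p)
          (c711 d)) :=
  sect2_sigma_allTori_of_prop12Printed hd hL ha (prop12Printed_allTori d L ha)

end

end Literature.MathematicalPhysics.QuantumFieldTheory.BalabanImbrieJaffe1984to88.BIJ85Sect72AllToriHolds
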